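import Literature.RepresentationTheory.MoeglinVignerasWaldspurger1987.RankOneThetaLiftRationalHyperbolicFrameDiagonal  -- ★ p836975 (F′): its isotropy conjunct `LemD1.IsIsotropic (LemD1OfPlace.standingData …)`
import Literature.NumberTheory.Automorphic.Liu2021.LemD1DataOfPlace                                                -- ★ `LemD1OfPlace.standingData`, `standingData_gram`, `localGram_eq`
import Literature.NumberTheory.Automorphic.UnitaryGroupSymplecticEmbedding                                           -- ★ `UnitaryGroup.hermForm`
import HarnessLib

/-!
# Crux `H413` — N3 ROAD (a), row (IB): THE ISOTROPY BRIDGE («`V` is isotropic» of Liu's standing data ⟷ a null vector for `UnitaryGroup.hermForm`)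

F0∕P2, cell `hodgecm-mathlib` (D-0151), crux item `stmt-HodgeConjecture-24833` (binder h413), programme P2, N3 road (a) of the K1 lead
B-p18 (g29) (deal 2026-08-31T23:57:29Z (IB)); seat B-p08 (g25).  THEOREMS ONLY (no `def`, no instance, no notation, no named fact, no `sorry`);
kernel lane `--supports stmt-HodgeConjecture-24833 --as helper`.  HONEST LABEL: HC_CM is proved only modulo the 2 remaining named inputs (hLiu418,
h413) — behind them the booked printed statements + the MOD package — until rung 0 closes; this file proves NO letter: it is the one-line dictionary
between two spellings of the same hermitian form, an input of the `hL` assembly (JA) of N3 #96 (`GelbartRogawski1991.thetaType_nonsplit_jacquetModule`).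

THE TWO SPELLINGS [Liu2021 App. D §D.1; Mok2014 §1].  ★ (F′) `RationalHyperbolicFrame.exists_rational_hyperbolic_realDiagonal_frame` exports the local
isotropy of the plane `(L_w², diag(a₁, a₂))` at a non-split `v` as «`V` is isotropic» of Liu's standing data, ★ `LemD1.IsIsotropic (LemD1OfPlace.standingData
L v c̄ 2 (diag(a) ⊗ 1) …)` := `∃ v ≠ 0, S.form v v = 0`, `S.form = ShimuraVarieties.hermForm S.σ S.gram` with `S.σ = conjLocal` (★ `standingData_conj_apply`)
and `S.gram = (J ⊗ 1)_v = J.map (algebraMap L (L ⊗ L⁺_v))` (★ `standingData_gram`, ★ `LemD1OfPlace.localGram_eq`); the block-frame files ★ (BF)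
`exists_hyperbolic_partner_of_nonsplit`, ★ (KL) `exists_unit_norm_kernelLineCM` take a vector `x ≠ 0` with ★ `UnitaryGroup.hermForm (conjLocal L c̄ v)
((Matrix.diagonal a).map (algebraMap L S)) x x = 0`.  Both `hermForm`s are `(σ ∘ x) ⬝ᵥ (H *ᵥ y)`; the bridge is definitional unfolding plus
`(diag a) ⊗ 1 ⊗ 1 = diag(ι a) ⊗ 1`.

§1 GENERIC (`E∕F` quadratic, any rank `N`, any hermitian non-degenerate `J`): `standingData_form_eq_hermForm`, `isIsotropic_standingData_iff`.
§2 THE CM DIAGONAL PLANE (the lead's head; the proof arguments of `standingData` are IMPLICIT, so the lemma applies to (F′)'s conjunct by unification):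
`exists_ne_zero_hermForm_self_eq_zero_of_isIsotropic`, and the converse `isIsotropic_standingData_of_hermForm_self_eq_zero`.

## References
* [Liu2021] Y. Liu, Camb. J. Math. 9 (2021) = arXiv:2102.11518: App. D §D.1, Lemma D.1 (4) («`V` is isotropic»).
* [Mok2014] C. P. Mok, Mem. AMS 235 (2015): §1 Notation p. 5 (the hermitian pairing `(σx)ᵀ J y`).
* [Omeara1963] O. T. O'Meara, *Introduction to Quadratic Forms* (1963): §63C 63:17–63:19 (local isotropy of the rank-2 plane).
-/

set_option autoImplicit false
-- the mandated namespace has the single-problem summit's repeated segment (`HodgeConjecture.HodgeConjecture`)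
set_option linter.dupNamespace false

noncomputable section

open NumberField IsDedekindDomain
open scoped Matrix

open Literature.NumberTheory Literature.NumberTheory.Automorphic Literature.NumberTheory.Automorphic.UnitaryGroup
open Literature.NumberTheory.Automorphic.Liu2021
open Literature.NumberTheory.GelbartRogawski1991 Literature.NumberTheory.GelbartRogawski1991.UnitaryDualPair
open Literature.RepresentationTheory.Liu2021 (OscillatorStandingData)

namespace Summit.HodgeConjecture.HodgeConjecture.Cruxes.H413.F0P2oBlockFrameIsotropyBridge

/-! ## §1 Generic: Liu's standing-data form IS `UnitaryGroup.hermForm (conjLocal) (J ⊗ 1)` -/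

section Generic

variable {F : Type} (E : Type) [Field F] [NumberField F] [Field E] [NumberField E] [Algebra F E] [Algebra.IsQuadraticExtension F E]
  (v : HeightOneSpectrum (𝓞 F)) (c : E ≃ₐ[F] E) {N : ℕ} {J : Matrix (Fin N) (Fin N) E}
  {δ : E} (hcδ : c δ = -δ) (hδ : δ ≠ 0) (hN : 2 ≤ N) (hJh : (J.map c)ᵀ = J) (hJdet : J.det ≠ 0)

/-- **the form of Liu's standing data at `v` is the tree's unitary-group pairing**: `S.form u w = hermForm (conjLocal E c v) (J ⊗ 1) u w`
(`S = LemD1OfPlace.standingData E v c N J …`; ★ `standingData_conj_apply`, ★ `standingData_gram`, ★ `LemD1OfPlace.localGram_eq`; both pairings are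
`(σ ∘ u) ⬝ᵥ (H *ᵥ w)`). [cite: Liu2021, App. D §D.1] [cite: Mok2014, §1 Notation p. 5] -/
theorem standingData_form_eq_hermForm (u w : Fin N → UnitaryGroup.LocalRing E v) :
    (LemD1OfPlace.standingData E v c N J hcδ hδ hN hJh hJdet).form u w =
      UnitaryGroup.hermForm (conjLocal E c v) (J.map (algebraMap E (UnitaryGroup.LocalRing E v))) u w := by
  unfold OscillatorStandingData.form Literature.AlgebraicGeometry.ShimuraVarieties.hermForm UnitaryGroup.hermForm
  rw [LemD1OfPlace.standingData_gram, LemD1OfPlace.localGram_eq]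
  rfl

/-- **«`V` is isotropic» ⟷ a null vector of `hermForm (conjLocal) (J ⊗ 1)`** (★ `LemD1.IsIsotropic` unfolded through `standingData_form_eq_hermForm`).
[cite: Liu2021, App. D Lemma D.1 (4)] [cite: Mok2014, §1 Notation p. 5] -/
theorem isIsotropic_standingData_iff :
    LemD1.IsIsotropic (LemD1OfPlace.standingData E v c N J hcδ hδ hN hJh hJdet) ↔
      ∃ x : Fin N → UnitaryGroup.LocalRing E v, x ≠ 0 ∧
        UnitaryGroup.hermForm (conjLocal E c v) (J.map (algebraMap E (UnitaryGroup.LocalRing E v))) x x = 0 := by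
  unfold LemD1.IsIsotropic
  simp only [standingData_form_eq_hermForm]

end Generic

/-! ## §2 The CM diagonal plane: (F′)'s isotropy conjunct ⟶ the `(x, hx0, hxx)` of ★ (BF)∕(KL) -/

section CM

variable (L : Type) [Field L] [NumberField L] [IsCMField L] (v : HeightOneSpectrum (𝓞 ↥(maximalRealSubfield L))) (a : Fin 2 → ↥(maximalRealSubfield L))

omit [IsCMField L] in
/-- `(diag a) ⊗ 1 ⊗ 1 = diag(ι a) ⊗ 1` in `M₂(L ⊗ L⁺_v)` (★ `Matrix.diagonal_map`). [folklore] -/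
private theorem diagonal_map_map_eq :
    ((Matrix.diagonal a).map (algebraMap (↥(maximalRealSubfield L)) L)).map (algebraMap L (UnitaryGroup.LocalRing L v)) =
      (Matrix.diagonal fun k : Fin 2 => algebraMap (↥(maximalRealSubfield L)) L (a k)).map (algebraMap L (UnitaryGroup.LocalRing L v)) := by
  rw [Matrix.diagonal_map (map_zero _)]

/-- **(IB) THE ISOTROPY BRIDGE** — from (F′) ★ `exists_rational_hyperbolic_realDiagonal_frame`'s conjunct «the plane `(L_w², diag(a₁, a₂))` is isotropic at `v`»
(`LemD1.IsIsotropic` of Liu's standing data for `J = diag(a) ⊗ 1`; the proof arguments `hcδ hδ hN hJh hJdet` are implicit and filled by unification) to the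
`(x, hx0, hxx)` binders of ★ (BF) `exists_hyperbolic_partner_of_nonsplit` ∕ ★ (KL) `exists_unit_norm_kernelLineCM` at `dV′ := Fin.cons (ι t) (ι ∘ a)` (after
`Fin.cons_succ`): a vector `x ≠ 0` of `(L ⊗ L⁺_v)²` with `hermForm (conjLocal L c̄ v) (diag(ι a) ⊗ 1) x x = 0`.
[cite: Liu2021, App. D Lemma D.1 (4)] [cite: Omeara1963, §63C 63:17–63:19] [cite: Mok2014, §1 Notation p. 5] -/
theorem exists_ne_zero_hermForm_self_eq_zero_of_isIsotropic {δ : L} {hcδ : IsCMField.complexConj L δ = -δ} {hδ : δ ≠ 0} {hN : 2 ≤ 2}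
    {hJh : (((Matrix.diagonal a).map (algebraMap (↥(maximalRealSubfield L)) L)).map (IsCMField.complexConj L))ᵀ =
      (Matrix.diagonal a).map (algebraMap (↥(maximalRealSubfield L)) L)}
    {hJdet : ((Matrix.diagonal a).map (algebraMap (↥(maximalRealSubfield L)) L)).det ≠ 0}
    (h : LemD1.IsIsotropic (LemD1OfPlace.standingData L v (IsCMField.complexConj L) 2
      ((Matrix.diagonal a).map (algebraMap (↥(maximalRealSubfield L)) L)) hcδ hδ hN hJh hJdet)) :
    ∃ x : Fin 2 → UnitaryGroup.LocalRing L v, x ≠ 0 ∧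
      UnitaryGroup.hermForm (conjLocal L (IsCMField.complexConj L) v)
        ((Matrix.diagonal fun k : Fin 2 => algebraMap (↥(maximalRealSubfield L)) L (a k)).map (algebraMap L (UnitaryGroup.LocalRing L v))) x x = 0 := by
  rw [← diagonal_map_map_eq]
  exact (isIsotropic_standingData_iff L v (IsCMField.complexConj L) hcδ hδ hN hJh hJdet).1 h

/-- **the converse bridge**: a null vector of `hermForm (conjLocal L c̄ v) (diag(ι a) ⊗ 1)` makes Liu's standing data for `J = diag(a) ⊗ 1` isotropic at `v`
(any admissible proof arguments). [cite: Liu2021, App. D Lemma D.1 (4)] [cite: Mok2014, §1 Notation p. 5] -/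
theorem isIsotropic_standingData_of_hermForm_self_eq_zero {δ : L} (hcδ : IsCMField.complexConj L δ = -δ) (hδ : δ ≠ 0) (hN : 2 ≤ 2)
    (hJh : (((Matrix.diagonal a).map (algebraMap (↥(maximalRealSubfield L)) L)).map (IsCMField.complexConj L))ᵀ =
      (Matrix.diagonal a).map (algebraMap (↥(maximalRealSubfield L)) L))
    (hJdet : ((Matrix.diagonal a).map (algebraMap (↥(maximalRealSubfield L)) L)).det ≠ 0)
    (x : Fin 2 → UnitaryGroup.LocalRing L v) (hx0 : x ≠ 0)
    (hxx : UnitaryGroup.hermForm (conjLocal L (IsCMField.complexConj L) v)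
      ((Matrix.diagonal fun k : Fin 2 => algebraMap (↥(maximalRealSubfield L)) L (a k)).map (algebraMap L (UnitaryGroup.LocalRing L v))) x x = 0) :
    LemD1.IsIsotropic (LemD1OfPlace.standingData L v (IsCMField.complexConj L) 2
      ((Matrix.diagonal a).map (algebraMap (↥(maximalRealSubfield L)) L)) hcδ hδ hN hJh hJdet) := by
  rw [← diagonal_map_map_eq] at hxx
  exact (isIsotropic_standingData_iff L v (IsCMField.complexConj L) hcδ hδ hN hJh hJdet).2 ⟨x, hx0, hxx⟩

/-- **(IB) at (F′)'s literal proof arguments** (`δ := imagUnit L`, ★ `complexConj_imagUnit`, ★ `imagUnit_ne_zero`, `le_refl 2`, ★ `diagonal_map_hermitian'`,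
★ `diagonal_map_det_ne_zero' … ha0`) — the same bridge with every argument explicit, for consumers who prefer `have` over unification.
[cite: Liu2021, App. D Lemma D.1 (4)] [cite: Omeara1963, §63C 63:17–63:19] -/
theorem exists_ne_zero_hermForm_self_eq_zero_of_isIsotropic' (ha0 : ∀ k, a k ≠ 0)
    (h : LemD1.IsIsotropic (LemD1OfPlace.standingData L v (IsCMField.complexConj L) 2
      ((Matrix.diagonal a).map (algebraMap (↥(maximalRealSubfield L)) L)) (complexConj_imagUnit L) (imagUnit_ne_zero L) (le_refl 2)
      (Literature.RepresentationTheory.MoeglinVignerasWaldspurger1987.RationalHyperbolicFrame.diagonal_map_hermitian' _ L (IsCMField.complexConj L) a)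
      (Literature.RepresentationTheory.MoeglinVignerasWaldspurger1987.RationalHyperbolicFrame.diagonal_map_det_ne_zero' _ L a ha0))) :
    ∃ x : Fin 2 → UnitaryGroup.LocalRing L v, x ≠ 0 ∧
      UnitaryGroup.hermForm (conjLocal L (IsCMField.complexConj L) v)
        ((Matrix.diagonal fun k : Fin 2 => algebraMap (↥(maximalRealSubfield L)) L (a k)).map (algebraMap L (UnitaryGroup.LocalRing L v))) x x = 0 :=
  exists_ne_zero_hermForm_self_eq_zero_of_isIsotropic L v a h

end CM

end Summit.HodgeConjecture.HodgeConjecture.Cruxes.H413.F0P2oBlockFrameIsotropyBridge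

end
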